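import Summits.CriticalPhenomena.CardyFormulaZ2.Theorems.CardyIKTransportIKLinearTransportWallDominationPlanarDefs
import Summits.CriticalPhenomena.CardyFormulaZ2.Theorems.CardyIKTransportIKLinearTransportStubBoxResamplerLaw

/-!
# `CardyIKTransport.IKLinearTransport` (stmt-CriticalPhenomena-5076), line `pinned-diagram-exchange`, lead c8 wave 3 —
# WALL DOMINATION, planar transfer: TRANSLATION INVARIANCE of the isotropic law on the thin-ring event

Theorem-only support file (`--supports stmt-CriticalPhenomena-5076`, registered sub-goal `stub_thinRingObs_shift`):
`(ν_univ).real (ThinRingObs a₀ b₀ s M) = (ν_univ).real (ThinRingObs 0 0 s M)`.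

Route.  (1) The law `νmix univ` of the observables of the everywhere-isotropic gauge is invariant under EVERY lattice
translation `shiftObs t` (`nuMix_univ_map_shiftObs`): vertically this is the landed stationarity `nuMix_map_vshift`
(…StubPinnedExchange); horizontally the landed re-anchoring `BoxResampler.nuMix_map_hshift` (…StubBoxResamplerLaw, from the
`μIK`-preserving lift `StubPatternLocality.exists_lift_hshift`) maps `ν_S` to the law of the shifted pattern
`{x | x - m ∈ S}`, which for `S = univ` is `univ` again.  (2) `shiftObs t` is a measurable BIJECTION of `Obs` (inverse
`shiftObs (-t)`; `StripLaw.measurable_shiftObs`), so the invariance holds for the mass of every set, measurable or not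
(`MeasurableEquiv.map_apply`; `nuMix_univ_preimage_shiftObs`) — no measurability of the event is needed.  (3) The thin-ring
event is translation covariant as a set (`shiftObs_mem_thinRingObs_iff`, `preimage_shiftObs_thinRingObs`): a black chain of
`cellGraph x.2` inside a region translates to a black chain of the translated triangulation inside the translated region
(the four adjacency clauses of `cellGraph` are translation invariant, `cellGraph_adj_shift`); wall cells, windows and the two
half-box regions translate along.
-/

noncomputable section

namespace Summit.CriticalPhenomena.CardyFormulaZ2.Theorems.IKLinearTransport.PinnedDiagramExchange.WallDomination

open scoped BigOperators Classical
open MeasureTheory Set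
open Summit.CriticalPhenomena.CardyFormulaZ2.Cruxes.IKMixedBoxCrossing.PairedMirrorExploration.StubPatternLocality
  (shiftObs vshift_eq_shiftObs)
open Literature.Probability.LatticeModels (Site)

namespace ThinRingObsShiftStub

/-! ## §1 Shifts of observables: inverses, invariance of `νmix univ` on every set -/

/-- The shift by `0` is the identity. -/
theorem shiftObs_zero (x : Obs) : shiftObs 0 x = x := by
  simp only [shiftObs, sub_zero, Set.preimage_id', Prod.mk.eta]

/-- Shifting by `t` and then by `-t` is the identity. -/
theorem shiftObs_neg_shiftObs (t : Site 2) (x : Obs) : shiftObs (-t) (shiftObs t x) = x := by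
  rw [BoxResampler.shiftObs_shiftObs, add_neg_cancel, shiftObs_zero]

/-- Shifting by `-t` and then by `t` is the identity. -/
theorem shiftObs_shiftObs_neg (t : Site 2) (x : Obs) : shiftObs t (shiftObs (-t) x) = x := by
  rw [BoxResampler.shiftObs_shiftObs, neg_add_cancel, shiftObs_zero]

/-- STATIONARITY OF THE ISOTROPIC LAW: every lattice translation preserves `νmix univ` (the landed vertical
stationarity `nuMix_map_vshift`, then the landed horizontal re-anchoring `BoxResampler.nuMix_map_hshift`, whose shifted
pattern `{x | x - t 0 ∈ univ}` is `univ`). -/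
theorem nuMix_univ_map_shiftObs (t : Site 2) : (νmix univ).map (shiftObs t) = νmix univ := by
  have ht : shiftObs t = shiftObs ![t 0, 0] ∘ vshift (t 1) := by
    funext x
    rw [Function.comp_apply, vshift_eq_shiftObs, BoxResampler.shiftObs_shiftObs]
    congr 1
    ext i
    fin_cases i <;> simp
  rw [ht, ← Measure.map_map (StripLaw.measurable_shiftObs _) (measurable_vshift _), nuMix_map_vshift,
    BoxResampler.nuMix_map_hshift]
  simp only [mem_univ, setOf_true]

/-- INVARIANCE OF THE MASS OF EVERY SET: `shiftObs t` is a measurable bijection, so `νmix univ (shiftObs t ⁻¹' E) =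
νmix univ E` for every `E ⊆ Obs`, measurable or not. -/
theorem nuMix_univ_preimage_shiftObs (t : Site 2) (E : Set Obs) :
    νmix univ (shiftObs t ⁻¹' E) = νmix univ E := by
  let e : Obs ≃ᵐ Obs :=
    { toFun := shiftObs t
      invFun := shiftObs (-t)
      left_inv := shiftObs_neg_shiftObs t
      right_inv := shiftObs_shiftObs_neg t
      measurable_toFun := StripLaw.measurable_shiftObs t
      measurable_invFun := StripLaw.measurable_shiftObs (-t) }
  calc νmix univ (shiftObs t ⁻¹' E) = (νmix univ).map e E := (MeasurableEquiv.map_apply e E).symm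
    _ = νmix univ E := by rw [show ((e : Obs ≃ᵐ Obs) : Obs → Obs) = shiftObs t from rfl, nuMix_univ_map_shiftObs]

/-! ## §2 Translation covariance of black chains and of the thin-ring event -/

/-- Adjacency in the triangulation read from the shifted anti-diagonal faces is shifted adjacency. -/
theorem cellGraph_adj_shift (t : Site 2) (A : Set (Site 2)) (u v : Site 2) :
    (cellGraph ((fun w => w - t) ⁻¹' A)).Adj u v ↔ (cellGraph A).Adj (u - t) (v - t) := by
  -- adapted from `cellGraph_adj_vshift` (…IKLinearTransportStubRowCFTPShift)
  simp only [cellGraph, SimpleGraph.fromRel_adj, Set.mem_preimage, ne_eq, sub_left_inj, sub_add_eq_add_sub]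

/-- A black chain inside `R` translates to a black chain of the shifted configuration inside any region containing
the translate of `R`. -/
theorem blackPathIn_shiftObs (t : Site 2) {x : Obs} {R R' : Set (Site 2)} (hR : ∀ v ∈ R, v + t ∈ R')
    {c d : Site 2} (h : BlackPathIn x R c d) : BlackPathIn (shiftObs t x) R' (c + t) (d + t) := by
  obtain ⟨p, hchain, hhead, hlast, hmem⟩ := h
  refine ⟨p.map (· + t), ?_, ?_, ?_, fun v hv => ?_⟩
  · refine List.isChain_map_of_isChain (· + t) (fun a b hab => ?_) hchain
    show (cellGraph ((fun w => w - t) ⁻¹' x.2)).Adj (a + t) (b + t)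
    rw [cellGraph_adj_shift, add_sub_cancel_right, add_sub_cancel_right]
    exact hab
  · rw [List.head?_map, hhead]
    rfl
  · rw [List.getLast?_map, hlast]
    rfl
  · obtain ⟨a, ha, rfl⟩ := List.mem_map.1 hv
    refine ⟨?_, hR a (hmem a ha).2⟩
    show a + t - t ∈ x.1
    rw [add_sub_cancel_right]
    exact (hmem a ha).1

/-- Translating the right half-box region. -/
theorem add_mem_rightRegion (t : Site 2) {a₀ b₀ : ℤ} {s M : ℕ} {v : Site 2} (hv : v ∈ rightRegion a₀ b₀ s M) :
    v + t ∈ rightRegion (a₀ + t 0) (b₀ + t 1) s M := by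
  simp only [rightRegion, Set.mem_setOf_eq, Pi.add_apply] at hv ⊢
  omega

/-- Translating the left half-box region. -/
theorem add_mem_leftRegion (t : Site 2) {a₀ b₀ : ℤ} {s M : ℕ} {v : Site 2} (hv : v ∈ leftRegion a₀ b₀ s M) :
    v + t ∈ leftRegion (a₀ + t 0) (b₀ + t 1) s M := by
  simp only [leftRegion, Set.mem_setOf_eq, Pi.add_apply] at hv ⊢
  omega

/-- Translating the upper window rows. -/
theorem add_mem_rowsA (c : ℤ) {b₀ : ℤ} {s M : ℕ} {y : ℤ} (hy : y ∈ rowsA b₀ s M) : y + c ∈ rowsA (b₀ + c) s M := by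
  simp only [rowsA, Set.mem_setOf_eq] at hy ⊢
  omega

/-- Translating the lower window rows. -/
theorem add_mem_rowsB (c : ℤ) {b₀ : ℤ} {s M : ℕ} {y : ℤ} (hy : y ∈ rowsB b₀ s M) : y + c ∈ rowsB (b₀ + c) s M := by
  simp only [rowsB, Set.mem_setOf_eq] at hy ⊢
  omega

/-- Translating the wall cells. -/
theorem wallCell_add (t : Site 2) (a₀ : ℤ) (s : ℕ) (y : ℤ) :
    wallCell a₀ s y + t = wallCell (a₀ + t 0) s (y + t 1) := by
  ext i
  fin_cases i
  · simp only [wallCell, Pi.add_apply, Fin.zero_eta, Fin.isValue, Matrix.cons_val_zero]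
    ring
  · simp only [wallCell, Pi.add_apply, Fin.mk_one, Fin.isValue, Matrix.cons_val_one, Matrix.cons_val_zero]

/-- COVARIANCE (one direction): translating a configuration of the thin-ring event anchored at `(a₀, b₀)` by `t` gives a
configuration of the event anchored at `(a₀ + t 0, b₀ + t 1)`. -/
theorem thinRingObs_shift_mem (t : Site 2) {a₀ b₀ : ℤ} {s M : ℕ} {x : Obs} (hx : x ∈ ThinRingObs a₀ b₀ s M) :
    shiftObs t x ∈ ThinRingObs (a₀ + t 0) (b₀ + t 1) s M := by
  simp only [ThinRingObs, Set.mem_setOf_eq] at hx ⊢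
  obtain ⟨u, hu, u', hu', v, hv, v', hv', hR, hL, hA, hB⟩ := hx
  have hRt : ∀ {y y' : ℤ}, BlackPathIn x (rightRegion a₀ b₀ s M) (wallCell a₀ s y) (wallCell a₀ s y') →
      BlackPathIn (shiftObs t x) (rightRegion (a₀ + t 0) (b₀ + t 1) s M) (wallCell (a₀ + t 0) s (y + t 1))
        (wallCell (a₀ + t 0) s (y' + t 1)) := fun h => by
    rw [← wallCell_add, ← wallCell_add]
    exact blackPathIn_shiftObs t (fun w hw => add_mem_rightRegion t hw) h
  have hLt : ∀ {y y' : ℤ}, BlackPathIn x (leftRegion a₀ b₀ s M) (wallCell a₀ s y) (wallCell a₀ s y') →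
      BlackPathIn (shiftObs t x) (leftRegion (a₀ + t 0) (b₀ + t 1) s M) (wallCell (a₀ + t 0) s (y + t 1))
        (wallCell (a₀ + t 0) s (y' + t 1)) := fun h => by
    rw [← wallCell_add, ← wallCell_add]
    exact blackPathIn_shiftObs t (fun w hw => add_mem_leftRegion t hw) h
  refine ⟨u + t 1, add_mem_rowsA _ hu, u' + t 1, add_mem_rowsA _ hu', v + t 1, add_mem_rowsB _ hv, v' + t 1,
    add_mem_rowsB _ hv', hRt hR, hLt hL, ?_, ?_⟩
  · exact Relation.ReflTransGen.lift (· + t 1)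
      (fun y y' h => ⟨add_mem_rowsA _ h.1, add_mem_rowsA _ h.2.1, h.2.2.imp hLt hRt⟩) u' u hA
  · exact Relation.ReflTransGen.lift (· + t 1)
      (fun y y' h => ⟨add_mem_rowsB _ h.1, add_mem_rowsB _ h.2.1, h.2.2.imp hLt hRt⟩) v' v hB

/-- COVARIANCE OF THE THIN-RING EVENT under translations of the configuration and of the anchor. -/
theorem shiftObs_mem_thinRingObs_iff (t : Site 2) (a₀ b₀ : ℤ) (s M : ℕ) (x : Obs) :
    shiftObs t x ∈ ThinRingObs (a₀ + t 0) (b₀ + t 1) s M ↔ x ∈ ThinRingObs a₀ b₀ s M := by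
  refine ⟨fun h => ?_, thinRingObs_shift_mem t⟩
  have h' := thinRingObs_shift_mem (-t) h
  rwa [shiftObs_neg_shiftObs, Pi.neg_apply, Pi.neg_apply, add_neg_cancel_right, add_neg_cancel_right] at h'

/-- The thin-ring event anchored at `(a₀, b₀)`, pulled back along the translation by `(a₀, b₀)`, is the event anchored at
the origin. -/
theorem preimage_shiftObs_thinRingObs (a₀ b₀ : ℤ) (s M : ℕ) :
    shiftObs ![a₀, b₀] ⁻¹' ThinRingObs a₀ b₀ s M = ThinRingObs 0 0 s M := by
  ext x
  have h := shiftObs_mem_thinRingObs_iff ![a₀, b₀] 0 0 s M x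
  simp only [Matrix.cons_val_zero, Matrix.cons_val_one, zero_add] at h
  exact h

end ThinRingObsShiftStub

open ThinRingObsShiftStub in
/-- **TRANSLATION INVARIANCE OF THE ISOTROPIC LAW ON THE THIN-RING EVENT** (registered sub-goal `stub_thinRingObs_shift`):
`ν_univ (ThinRingObs a₀ b₀ s M) = ν_univ (ThinRingObs 0 0 s M)` — the event anchored at `(a₀, b₀)` is the translate of
the event at the origin, and `νmix univ` is invariant under all lattice translations. -/
theorem stub_thinRingObs_shift : ThinRingObs_shift := by
  intro a₀ b₀ s M
  rw [measureReal_def, measureReal_def, ← preimage_shiftObs_thinRingObs a₀ b₀ s M, nuMix_univ_preimage_shiftObs]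

end Summit.CriticalPhenomena.CardyFormulaZ2.Theorems.IKLinearTransport.PinnedDiagramExchange.WallDomination

end
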